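import Mathlib
import Literature.MathematicalPhysics.QuantumFieldTheory.Balaban1983to89.B6SectA

/-!
# `Balaban1983to89.B6Eq231` — T. Bałaban, *Propagators and renormalization transformations for lattice gauge
theories. II*, Commun. Math. Phys. **96** (1984) 223–250 [Balaban1984PropagatorsII]: the Faddeev–Popov identities
(2.31) `R∂*G∂R = R` and (2.34) `R∂*GQ* = 0`, `QG∂R = 0` PROVED from the structural identities of Sect. A

statement-level skeleton of published theorems with citation tags; proofs where landed; nothing here is a claim about the
Yang–Mills mass gap.
PDF held: `paper:balaban1984-cmp96-propagators-rt-ii` (journal page = PDF page + 222); pp. 226–228 [PDF 4–6] read from the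
×2 renders `run/shared/lean/pub/pub-balaban/b2b-balaban-ref1/pages/1984-cmp96-propagators-rt-II/…-p004…p006-x2.png`.

CITATION HEADER (cell `lit-balaban`, reader/typer r03, SKELETON rows `B6.Eq2.31`, `B6.Eq2.34` of `HOME/lit-balaban-r03/
ROWS-B6.md`; companion of `…Balaban1983to89.B6SectA` (p238845), which is IMPORTED, not modified, and whose theorem
`B6SectA.critical221_unique` ((2.21) ⇒ (2.35)) takes (2.31) and (2.34) as the named hypotheses `h231`, `h234`).
WHAT THE PAPER PRINTS (p. 227–228, verbatim): *"Let us consider the operator R∂*G∂R. We have e^{½⟨f,R∂*G∂Rf⟩} =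
Z⁻¹∫dA e^{−½⟨A,Δ_aA⟩+⟨f,R∂*A⟩} = … (2.28) Applying the Faddeev-Popov procedure … (2.29) … (2.30) The last equality follows
from the identity (2.26) and from the presence of the δ-function δ_R(R∂*A). Thus R∂*G∂R = R. (2.31) Now we consider the
operator R∂*GQ*. … (2.32) Applying the same operations as in (2.28)–(2.30) we get … = 0. (2.33) … Hence we have
R∂*GQ* = 0, QG∂R = 0. (2.34) The equalities (2.31), (2.34) are generalizations of the equalities (1.97), (1.95) in [4]"*;
and the structural facts used below, also printed: (2.19) p. 226 *"Δ_a = ∂*∂ + ∂R∂* + Q*aQ"*; p. 225 *"let R be an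
orthogonal projection in the space L²(T_η) onto the subspace ΔN(Q′)"* with (2.8) Δ = ∂*∂ on scalars; p. 227 *"Because
Q′λ′ = 0, hence QA^{λ′} = QA − ∂₁Q′λ′ = QA"* (the averages (2.6) are invariant under the gauge group (2.7)).
WHAT IS PROVED HERE (0 sorry, 0 named facts).  The print derives (2.31), (2.34) by Gaussian integration; this module
proves them ALGEBRAICALLY from the identities the integrals encode — so they are theorems, not hypotheses, for every
linear realisation of Sect. A with: `C ∘ ∂ = 0` (the curl–curl part ∂*∂ of (2.19) kills gradients: ∂(∂λ) = 0),
`Q(∂λ) = 0 for λ ∈ N(Q′)` (gauge invariance of (2.6)), `R` maps into and fixes ΔN(Q′), `G` a left inverse of Δ_a: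
(i) `G∂Rf = ∂λ` for `Rf = Δλ`, λ ∈ N(Q′) (`apply_G_d_R`) — the mechanism; (ii) **(2.34)₂ `QG∂R = 0`** (`eq234_right`);
(iii) `∂*G∂R = R`, hence **(2.31) `R∂*G∂R = R`** (`dstar_G_d_R`, `eq231`; `R² = R` is derived, `R_idem`);
(iv) in real inner-product spaces with ∂* the adjoint of ∂, Q′* the adjoint of Q′, `∂* ∘ C = 0` and the adjoint
intertwining `∂*Q* = Q′*D*` of Q∂ = DQ′ ([4] (1.13)-type), `G` a right inverse of Δ_a: **(2.34)₁ `R∂*GQ* = 0`**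
(`eq234_left`) — by the printed-style argument "Δ(R∂*GQ*ω) ∈ Q′*(…) and R∂*GQ*ω ∈ ΔN(Q′) force it to vanish";
(v) hence `B6SectA.critical221_unique` with `h231`, `h234` DISCHARGED (`critical221_unique_structural`): the unique
critical configuration (2.35) A = GQ*(QGQ*)⁻¹B under invertibility of Δ_a and of QGQ* alone — *"The only assumption we
have used was the positivity of the operator Δ_a, a > 0, or G"* (p. 228).
-/

namespace Literature.MathematicalPhysics.QuantumFieldTheory.Balaban1983to89.B6Eq231

/-! ## §1. The algebraic identities: (2.34)₂ and (2.31) -/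

section Algebra

variable {R : Type*} [CommRing R]
variable {V A W W' : Type*} [AddCommGroup V] [Module R V] [AddCommGroup A] [Module R A] [AddCommGroup W]
  [Module R W] [AddCommGroup W'] [Module R W']

/-- The mechanism behind (2.31)/(2.34) (pp. 227–228): if `Rf = Δλ = ∂*∂λ` with `λ ∈ N(Q′)`, then `Δ_a(∂λ) = ∂Rf`
(the curl–curl term and the averaging term of (2.19) vanish on the pure gauge `∂λ`, and `R` fixes `Δλ`), hence
`G∂Rf = ∂λ` for any left inverse `G` of `Δ_a = C + ∂R∂* + Q*aQ`. [cite: Balaban1984PropagatorsII, (2.28)–(2.31) p.227] -/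
theorem apply_G_d_R (C G : A →ₗ[R] A) (d : V →ₗ[R] A) (dstar : A →ₗ[R] V) (Rp : V →ₗ[R] V) (Qp : V →ₗ[R] W')
    (Q : A →ₗ[R] W) (Qs : W →ₗ[R] A) (a : W →ₗ[R] W)
    (hCd : C ∘ₗ d = 0) (hQd : ∀ n ∈ B6SectA.gaugeSpace Qp, Q (d n) = 0)
    (hRfix : ∀ n ∈ B6SectA.gaugeSpace Qp, Rp (dstar (d n)) = dstar (d n))
    (hG : G ∘ₗ (C + d ∘ₗ Rp ∘ₗ dstar + Qs ∘ₗ a ∘ₗ Q) = LinearMap.id)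
    {f n : V} (hn : n ∈ B6SectA.gaugeSpace Qp) (hRf : Rp f = dstar (d n)) :
    G (d (Rp f)) = d n := by
  have hCd' : C (d n) = 0 := by simpa using LinearMap.congr_fun hCd n
  have hG' : ∀ x, G ((C + d ∘ₗ Rp ∘ₗ dstar + Qs ∘ₗ a ∘ₗ Q) x) = x := fun x => by
    simpa using LinearMap.congr_fun hG x
  have key : (C + d ∘ₗ Rp ∘ₗ dstar + Qs ∘ₗ a ∘ₗ Q) (d n) = d (Rp f) := by
    simp only [LinearMap.add_apply, LinearMap.coe_comp, Function.comp_apply, hCd', hQd n hn, map_zero, add_zero,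
      zero_add, hRfix n hn, hRf]
  have := hG' (d n)
  rw [key] at this
  exact this

/-- **(2.34), second identity, PROVED: `QG∂R = 0`** — for `R` mapping into `ΔN(Q′)` and fixing it, `C∂ = 0`,
`Q∂λ = 0 (λ ∈ N(Q′))`, `G` a left inverse of `Δ_a`. [cite: Balaban1984PropagatorsII, (2.34) p.228] -/
theorem eq234_right (C G : A →ₗ[R] A) (d : V →ₗ[R] A) (dstar : A →ₗ[R] V) (Rp : V →ₗ[R] V) (Qp : V →ₗ[R] W')
    (Q : A →ₗ[R] W) (Qs : W →ₗ[R] A) (a : W →ₗ[R] W)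
    (hCd : C ∘ₗ d = 0) (hQd : ∀ n ∈ B6SectA.gaugeSpace Qp, Q (d n) = 0)
    (hRrange : ∀ f, ∃ n ∈ B6SectA.gaugeSpace Qp, Rp f = dstar (d n))
    (hRfix : ∀ n ∈ B6SectA.gaugeSpace Qp, Rp (dstar (d n)) = dstar (d n))
    (hG : G ∘ₗ (C + d ∘ₗ Rp ∘ₗ dstar + Qs ∘ₗ a ∘ₗ Q) = LinearMap.id) :
    Q ∘ₗ G ∘ₗ d ∘ₗ Rp = 0 := by
  ext f
  obtain ⟨n, hn, hRf⟩ := hRrange f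
  simp only [LinearMap.coe_comp, Function.comp_apply, LinearMap.zero_apply]
  rw [apply_G_d_R C G d dstar Rp Qp Q Qs a hCd hQd hRfix hG hn hRf]
  exact hQd n hn

/-- `∂*G∂R = R` (the un-projected form of (2.31)): with `Rf = Δλ`, `∂*G∂Rf = ∂*∂λ = Δλ = Rf`.
[cite: Balaban1984PropagatorsII, (2.31) p.227] -/
theorem dstar_G_d_R (C G : A →ₗ[R] A) (d : V →ₗ[R] A) (dstar : A →ₗ[R] V) (Rp : V →ₗ[R] V) (Qp : V →ₗ[R] W')
    (Q : A →ₗ[R] W) (Qs : W →ₗ[R] A) (a : W →ₗ[R] W)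
    (hCd : C ∘ₗ d = 0) (hQd : ∀ n ∈ B6SectA.gaugeSpace Qp, Q (d n) = 0)
    (hRrange : ∀ f, ∃ n ∈ B6SectA.gaugeSpace Qp, Rp f = dstar (d n))
    (hRfix : ∀ n ∈ B6SectA.gaugeSpace Qp, Rp (dstar (d n)) = dstar (d n))
    (hG : G ∘ₗ (C + d ∘ₗ Rp ∘ₗ dstar + Qs ∘ₗ a ∘ₗ Q) = LinearMap.id) :
    dstar ∘ₗ G ∘ₗ d ∘ₗ Rp = Rp := by
  ext f
  obtain ⟨n, hn, hRf⟩ := hRrange f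
  simp only [LinearMap.coe_comp, Function.comp_apply]
  rw [apply_G_d_R C G d dstar Rp Qp Q Qs a hCd hQd hRfix hG hn hRf, hRf]

/-- `R` is idempotent as soon as it maps into `ΔN(Q′)` and fixes it (in print: R is the orthogonal projection onto
`ΔN(Q′)`, p. 225). [cite: Balaban1984PropagatorsII, (2.10)–(2.12) p.225] -/
theorem R_idem (d : V →ₗ[R] A) (dstar : A →ₗ[R] V) (Rp : V →ₗ[R] V) (Qp : V →ₗ[R] W')
    (hRrange : ∀ f, ∃ n ∈ B6SectA.gaugeSpace Qp, Rp f = dstar (d n))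
    (hRfix : ∀ n ∈ B6SectA.gaugeSpace Qp, Rp (dstar (d n)) = dstar (d n)) :
    Rp ∘ₗ Rp = Rp := by
  ext f
  obtain ⟨n, hn, hRf⟩ := hRrange f
  simp only [LinearMap.coe_comp, Function.comp_apply]
  rw [hRf, hRfix n hn]

/-- **(2.31) PROVED: `R∂*G∂R = R`.** [cite: Balaban1984PropagatorsII, (2.31) p.227] -/
theorem eq231 (C G : A →ₗ[R] A) (d : V →ₗ[R] A) (dstar : A →ₗ[R] V) (Rp : V →ₗ[R] V) (Qp : V →ₗ[R] W')
    (Q : A →ₗ[R] W) (Qs : W →ₗ[R] A) (a : W →ₗ[R] W)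
    (hCd : C ∘ₗ d = 0) (hQd : ∀ n ∈ B6SectA.gaugeSpace Qp, Q (d n) = 0)
    (hRrange : ∀ f, ∃ n ∈ B6SectA.gaugeSpace Qp, Rp f = dstar (d n))
    (hRfix : ∀ n ∈ B6SectA.gaugeSpace Qp, Rp (dstar (d n)) = dstar (d n))
    (hG : G ∘ₗ (C + d ∘ₗ Rp ∘ₗ dstar + Qs ∘ₗ a ∘ₗ Q) = LinearMap.id) :
    Rp ∘ₗ dstar ∘ₗ G ∘ₗ d ∘ₗ Rp = Rp := by
  have h1 := dstar_G_d_R C G d dstar Rp Qp Q Qs a hCd hQd hRrange hRfix hG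
  have h2 := R_idem d dstar Rp Qp hRrange hRfix
  -- `∘ₗ` is right-nested: `Rp ∘ₗ (dstar ∘ₗ G ∘ₗ d ∘ₗ Rp)`
  rw [h1]
  exact h2

end Algebra

/-! ## §2. (2.34)₁ `R∂*GQ* = 0` (real inner-product spaces) and the discharge of `B6SectA.critical221_unique` -/

section Inner

variable {V A W W' : Type*} [NormedAddCommGroup V] [InnerProductSpace ℝ V] [NormedAddCommGroup A]
  [InnerProductSpace ℝ A] [NormedAddCommGroup W] [InnerProductSpace ℝ W] [NormedAddCommGroup W']
  [InnerProductSpace ℝ W']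

/-- **(2.34), first identity, PROVED: `R∂*GQ* = 0`.**  Hypotheses: `∂*` the adjoint of `∂` and `Q′*` the adjoint of
`Q′` (the pairings of Sect. A), `∂* ∘ C = 0` (= the adjoint of `C∂ = 0`), the adjoint intertwining `∂*Q* = Q′*D′` of
the printed `Q(∂λ) = (coarse ∂)(Q′λ)` (p. 227 / [4]), `R` maps into `ΔN(Q′)`, and `G` a right inverse of
`Δ_a = C + ∂R∂* + Q*aQ`.  Proof (the content of (2.32)–(2.33)): for `B = GQ*ω`, applying `∂*` to `Δ_aB = Q*ω` gives
`Δ(R∂*B) ∈ Q′*(W)`; writing `R∂*B = Δλ`, `λ ∈ N(Q′)`, and pairing with `λ` gives `‖Δλ‖² = ⟨Q′λ, ·⟩ = 0`.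
[cite: Balaban1984PropagatorsII, (2.32)–(2.34) pp.227–228] -/
theorem eq234_left (C G : A →ₗ[ℝ] A) (d : V →ₗ[ℝ] A) (dstar : A →ₗ[ℝ] V) (Rp : V →ₗ[ℝ] V) (Qp : V →ₗ[ℝ] W')
    (Qps : W' →ₗ[ℝ] V) (Ds : W →ₗ[ℝ] W') (Q : A →ₗ[ℝ] W) (Qs : W →ₗ[ℝ] A) (a : W →ₗ[ℝ] W)
    (hadj_d : ∀ (B : A) (v : V), inner ℝ (dstar B) v = inner ℝ B (d v))
    (hadj_Q : ∀ (w : W') (v : V), inner ℝ (Qps w) v = inner ℝ w (Qp v))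
    (hdC : dstar ∘ₗ C = 0) (hdQ : dstar ∘ₗ Qs = Qps ∘ₗ Ds)
    (hRrange : ∀ f, ∃ n ∈ B6SectA.gaugeSpace Qp, Rp f = dstar (d n))
    (hG : (C + d ∘ₗ Rp ∘ₗ dstar + Qs ∘ₗ a ∘ₗ Q) ∘ₗ G = LinearMap.id) :
    Rp ∘ₗ dstar ∘ₗ G ∘ₗ Qs = 0 := by
  ext ω
  simp only [LinearMap.coe_comp, Function.comp_apply, LinearMap.zero_apply]
  set B := G (Qs ω) with hB
  -- Δ_a B = Q* ω
  have hΔB : (C + d ∘ₗ Rp ∘ₗ dstar + Qs ∘ₗ a ∘ₗ Q) B = Qs ω := by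
    simpa using LinearMap.congr_fun hG (Qs ω)
  have hdC' : ∀ x, dstar (C x) = 0 := fun x => by simpa using LinearMap.congr_fun hdC x
  have hdQ' : ∀ w, dstar (Qs w) = Qps (Ds w) := fun w => by simpa using LinearMap.congr_fun hdQ w
  -- apply ∂* : Δ(R∂*B) = Q′*(D′ω − D′aQB)
  have h1 : dstar (d (Rp (dstar B))) = Qps (Ds ω - Ds (a (Q B))) := by
    have := congrArg dstar hΔB
    simp only [LinearMap.add_apply, LinearMap.coe_comp, Function.comp_apply, map_add, hdC', zero_add, hdQ'] at this
    rw [map_sub, ← this, add_sub_cancel_right]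
  -- R∂*B = Δλ with λ ∈ N(Q′); pair Δ(Δλ) = Q′*w with λ
  obtain ⟨n, hn, hRn⟩ := hRrange (dstar B)
  have hn' : Qp n = 0 := hn
  have h2 : inner ℝ (dstar (d n)) (dstar (d n)) = 0 := by
    calc inner ℝ (dstar (d n)) (dstar (d n)) = inner ℝ (d n) (d (dstar (d n))) := hadj_d _ _
      _ = inner ℝ (d (dstar (d n))) (d n) := by rw [real_inner_comm]
      _ = inner ℝ (dstar (d (dstar (d n)))) n := (hadj_d _ _).symm
      _ = inner ℝ n (dstar (d (dstar (d n)))) := by rw [real_inner_comm]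
      _ = inner ℝ n (Qps (Ds ω - Ds (a (Q B)))) := by rw [← hRn, h1]
      _ = inner ℝ (Qps (Ds ω - Ds (a (Q B)))) n := by rw [real_inner_comm]
      _ = 0 := by rw [hadj_Q, hn', inner_zero_right]
  have h3 : dstar (d n) = 0 := inner_self_eq_zero.mp h2
  rw [hRn, h3]

/-- **(2.21) ⇒ (2.35) with the Faddeev–Popov identities DISCHARGED.**  `B6SectA.critical221_unique` with its hypotheses
`h231` (2.31) and `h234` (2.34) replaced by the structural identities of Sect. A from which this module proves them:
every solution `(A, λ, ω)`, `Rλ = λ`, of the critical-point equations (2.21) has `λ = 0`, `ω = (QGQ*)⁻¹B`,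
`A = HB = GQ*(QGQ*)⁻¹B` — under the invertibility of `Δ_a` (left and right inverse `G`) and of `QGQ*` (left inverse
`E`) only: *"The only assumption we have used was the positivity of the operator Δ_a, a > 0, or G."* (p. 228).
[cite: Balaban1984PropagatorsII, (2.35) p.228] -/
theorem critical221_unique_structural (C G : A →ₗ[ℝ] A) (d : V →ₗ[ℝ] A) (dstar : A →ₗ[ℝ] V) (Rp : V →ₗ[ℝ] V)
    (Qp : V →ₗ[ℝ] W') (Qps : W' →ₗ[ℝ] V) (Ds : W →ₗ[ℝ] W') (Q : A →ₗ[ℝ] W) (Qs : W →ₗ[ℝ] A) (a : W →ₗ[ℝ] W)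
    (E : W →ₗ[ℝ] W)
    (hadj_d : ∀ (B : A) (v : V), inner ℝ (dstar B) v = inner ℝ B (d v))
    (hadj_Q : ∀ (w : W') (v : V), inner ℝ (Qps w) v = inner ℝ w (Qp v))
    (hCd : C ∘ₗ d = 0) (hdC : dstar ∘ₗ C = 0) (hQd : ∀ n ∈ B6SectA.gaugeSpace Qp, Q (d n) = 0)
    (hdQ : dstar ∘ₗ Qs = Qps ∘ₗ Ds)
    (hRrange : ∀ f, ∃ n ∈ B6SectA.gaugeSpace Qp, Rp f = dstar (d n))
    (hRfix : ∀ n ∈ B6SectA.gaugeSpace Qp, Rp (dstar (d n)) = dstar (d n))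
    (hGl : G ∘ₗ (C + d ∘ₗ Rp ∘ₗ dstar + Qs ∘ₗ a ∘ₗ Q) = LinearMap.id)
    (hGr : (C + d ∘ₗ Rp ∘ₗ dstar + Qs ∘ₗ a ∘ₗ Q) ∘ₗ G = LinearMap.id)
    (hE : E ∘ₗ (Q ∘ₗ G ∘ₗ Qs) = LinearMap.id)
    {B : W} {A' : A} {lam : V} {ω : W} (hR : Rp lam = lam)
    (h1 : (C + d ∘ₗ Rp ∘ₗ dstar + Qs ∘ₗ a ∘ₗ Q) A' - d (Rp lam) - Qs ω = 0) (h2 : Rp (dstar A') = 0)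
    (h3 : Q A' = B) :
    lam = 0 ∧ ω = E B ∧ A' = B6SectA.hOp G Qs E B :=
  B6SectA.critical221_unique (C + d ∘ₗ Rp ∘ₗ dstar + Qs ∘ₗ a ∘ₗ Q) G d dstar Rp Q Qs E hGl
    (eq231 C G d dstar Rp Qp Q Qs a hCd hQd hRrange hRfix hGl)
    (eq234_left C G d dstar Rp Qp Qps Ds Q Qs a hadj_d hadj_Q hdC hdQ hRrange hGr) hE hR h1 h2 h3

end Inner

end Literature.MathematicalPhysics.QuantumFieldTheory.Balaban1983to89.B6Eq231
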